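import Summits.QuantumFields.BalabanUV.T4Continuum.Support.NE7K1LinTwoRunFaces

/-!
# NE7K1LinHomTrial — row NE7 (node U5), candidate route HOM, path H1L, cell K1-lin(s): THE SCHUR FORM OF RUN B IS BELOW THE
# RUN-B FORM OF EVERY FINE TRIAL WITH EXACT BLOCK SUMS, and the REDUCTION of the upper two-run comparison
# `P_B^{Schur} ⪯ C·P_A` to a Dirichlet (nearest-neighbour energy) comparison `L²·E_fine(φ) ≤ C·L^{d+1}·E_coarse(V)`

Lineage `b2b-balaban-t4-ne7-p2` (CRUX PROVER NE7 #2), generation 66.  First file of the HOMOGENISED upper constant (g65 OPEN item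
(4)(ii); lens 2's supplier number (K2)♯-U, t4-ne7-idea-2 g35 `HOME/t4/ideate/NE7/lens2-g35/K2-UPPER-LDEP-NOTE.md`: on the alternating
coarse field the two-run ratio tends to `ρ(L) = 3L²∕(L² + 2) ↑ 3`, so the block-constant trial's constant `L`
(`NE7K1LinTwoRunFaces.schurB_form_le_sharp`) is NOT the Löwner constant for `L ≥ 3`).  Objects of `NE7K1LinSchurLineU1` ∕
`NE7K1LinBlockCoords` ∕ `NE7K1LinTwoRunKit`: `R′` a union of `nL`-blocks, `R = R′.image (blk L)`, `runA = P_A = fineOpR n a 0 R`,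
`runB = L^{−(d+1)}·Tᵀ·fineOpR (nL) a 0 R′·T` in block coordinates `T(V,ψ)`, `twoCutoffLine … 1 = P_B^{Schur}`.  All [folklore]:

* `schurB_form_le_trial_fluct`: `⟨V,P_B^{Schur}V⟩ ≤ ⟨(V,ψ), runB (V,ψ)⟩` for EVERY in-block fluctuation `ψ` (completing the square,
  `NE7K1LinTwoRunKit.schur_form_le`; `NE7K1LinTwoRunUpper.schurB_form_le_trial` was `ψ = 0`).
* `coordT_fluct`: a fine `φ` with `Σ_{x′ ∈ block b} φ x′ = L^{d+1}V_b` for all `b` IS `T(V, ψ)` with `ψ_{b,j} = φ(Lb+j) − V_b`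
  (`j ≠ 0`) — the anchor value `φ(Lb)` is recovered from the block sum.
* **`schurB_form_le_of_blockSum`**: `⟨V,P_B^{Schur}V⟩ ≤ L^{−(d+1)}·⟨φ, fineOpR (nL) a 0 R′ φ⟩` for every such `φ` — the constrained
  minimum behind the Schur complement in the form a trial function consumes.
* **`schurB_form_le_of_dirichlet`**: if moreover `L²·Σ_{x′}Σ_{y′~x′}(φ x′ − φ y′)² ≤ C·L^{d+1}·Σ_xΣ_{y~x}(V_x − V_y)²` with `C ≥ 1`
  then `⟨V,P_B^{Schur}V⟩ ≤ C·⟨V,P_A V⟩`: the averaging parts are EQUAL (`avgPart_eq`), the Dirichlet parts carry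
  `L^{−(d+1)}·(nL)²` against `n²`.  The block-constant lift gives `C = L`; the next files (`NE7K1LinHomKernel`, `…HomLift`,
  `…HomUpper`) feed it a lift with gradients spread over the block and obtain `C = C(d)` INDEPENDENT OF `L` on boxes.

HONEST FRAMING: Gaussian `A = 0`, finite regions, finite real matrices, [folklore] over the tree's `B4Lower18` ∕ `NE7K1Lin*`
certificates; ONE RG step in `U = 1` gauge; nothing printed asserted; no `sorry`.  FIXED FINITE T⁴, rung (B)+1; NE7 NOT PRINTED ∕ NOT
PROVED; spine 0∕9; NOT infinite volume, NOT mass gap, NOT Clay.  HONEST DEPENDENCY: continuum YM on T⁴ ⇐ BetaPertH ∧ nine spine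
estimates (0/9 proved); BetaPertH ⇐ (D1) ∧ (D4) ∧ CAP+tail; G-an2-4 gates asym, D1 and NE2/3/4.
-/

noncomputable section

open Finset Matrix

namespace Summit.QuantumFields.BalabanUV.T4Continuum.NE7K1LinHomTrial

open Literature.MathematicalPhysics.QuantumFieldTheory.Balaban1983to89
open Literature.MathematicalPhysics.QuantumFieldTheory.Balaban1983to89.B4Reflection242
open Literature.MathematicalPhysics.QuantumFieldTheory.Balaban1983to89.B4BoxCov237
open Literature.MathematicalPhysics.QuantumFieldTheory.Balaban1983to89.B4Lower18
open Literature.MathematicalPhysics.QuantumFieldTheory.Balaban1983to89.B4Thm110ZeroBox (blk_blk)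
open Literature.MathematicalPhysics.QuantumFieldTheory.Balaban1983to89.B4Green244 (finePt)
open NE7K1LinSchurLineForm NE7K1LinSchurLineCoords NE7K1LinBlockCoords NE7K1LinSchurLineU1 NE7K1LinTwoRunKit
  NE7K1LinTwoRunUpper NE7K1LinTwoRunBonds NE7K1LinTwoRunLower NE7K1LinTwoRunLines NE7K1LinTwoRunJensen NE7K1LinTwoRunFaces

variable {d : ℕ}

section Trial

variable {n L : ℕ} [NeZero L] {R' : Finset (Fin (d + 1) → ℤ)}

/-- **THE SCHUR FORM IS BELOW EVERY TRIAL IN BLOCK COORDINATES**: `⟨V,P_B^{Schur}V⟩ ≤ ⟨(V,ψ), runB (V,ψ)⟩` for every in-block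
fluctuation `ψ` (`a > 0`, `R′` a union of `nL`-blocks, `n ≥ 1`); `NE7K1LinTwoRunUpper.schurB_form_le_trial` is the case `ψ = 0`.
[folklore] -/
theorem schurB_form_le_trial_fluct (hn : 1 ≤ n) (hR' : IsBlockUnion (n * L) R') {a : ℝ} (ha : 0 < a)
    (V : ↥(R'.image (blk L)) → ℝ) (ψ : ↥(R'.image (blk L)) × NZ d L → ℝ) :
    V ⬝ᵥ (twoCutoffLine (isBlockUnion_fine hR') n a 1).mulVec V ≤
      Sum.elim V ψ ⬝ᵥ (runB (isBlockUnion_fine hR') n a).mulVec (Sum.elim V ψ) := by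
  have hR'L : IsBlockUnion L R' := isBlockUnion_fine hR'
  have hnL : 1 ≤ n * L := Nat.one_le_iff_ne_zero.2 (Nat.mul_ne_zero (Nat.one_le_iff_ne_zero.1 hn) (NeZero.ne L))
  have hLpow : (0 : ℝ) < (L : ℝ) ^ (d + 1) := pow_pos (by exact_mod_cast (NeZero.one_le : 1 ≤ L)) _
  have hmin : 0 < min 2 a := lt_min (by norm_num) ha
  set H := runB hR'L n a with hH
  have hsymm : H.IsSymm := runB_isSymm hR'L n a
  have hblocks := (Matrix.isSymm_fromBlocks_iff.1 (by rw [fromBlocks_toBlocks H]; exact hsymm))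
  have hH₁ : ∀ u, min 2 a / (L : ℝ) ^ (d + 1) * (u ⬝ᵥ u) ≤ u ⬝ᵥ H.mulVec u := by
    intro u
    have h := coercive_congr (coordT hR'L) (fineOpR (n * L) a 0 R') (c := ((L : ℝ) ^ (d + 1))⁻¹) (σM := min 2 a)
      (cT := 1) (by positivity) hmin.le (fun φ => lower18_zero hnL ha.le hR' φ) (dot_le_coordT hR'L) u
    have hσ' : ((L : ℝ) ^ (d + 1))⁻¹ * min 2 a * 1 = min 2 a / (L : ℝ) ^ (d + 1) := by field_simp
    rw [hσ'] at h
    exact h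
  have hH₁' : ∀ u, min 2 a / (L : ℝ) ^ (d + 1) * (u ⬝ᵥ u) ≤
      u ⬝ᵥ (fromBlocks H.toBlocks₁₁ H.toBlocks₁₂ H.toBlocks₂₁ H.toBlocks₂₂).mulVec u := by
    rw [fromBlocks_toBlocks]; exact hH₁
  have hDu : IsUnit (H.toBlocks₂₂).det := isUnit_det_fineR _ _ _ _ (div_pos hmin hLpow) hH₁'
  have hDpsd : ∀ φ, 0 ≤ φ ⬝ᵥ (H.toBlocks₂₂).mulVec φ := fun φ =>
    le_trans (mul_nonneg (div_pos hmin hLpow).le (by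
      simp only [dotProduct]; exact Finset.sum_nonneg fun _ _ => mul_self_nonneg _))
      (NE7K1LinSchurLineDeriv.coercive_D _ _ _ _ hH₁' φ)
  have h := schur_form_le H.toBlocks₁₁ H.toBlocks₁₂ H.toBlocks₂₁ H.toBlocks₂₂ hblocks.2.1 hblocks.2.2.2 hDu hDpsd V ψ
  rw [fromBlocks_toBlocks] at h
  rw [twoCutoffLine_one]
  exact h

/-- **EVERY FINE FUNCTION WITH BLOCK SUMS `L^{d+1}V` IS A TRIAL `T(V,ψ)`**, namely with the in-block fluctuation
`ψ_{b,j} = φ(Lb + j) − V_b` (`j ≠ 0`). [folklore] -/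
theorem coordT_fluct (hR'L : IsBlockUnion L R') (V : ↥(R'.image (blk L)) → ℝ) (φ : ↥R' → ℝ)
    (hφ : ∀ b, ∑ x' ∈ Finset.univ.filter (fun x' => rblk L R' x' = b), φ x' = (L : ℝ) ^ (d + 1) * V b) :
    (coordT hR'L).mulVec (Sum.elim V
      (fun bj : ↥(R'.image (blk L)) × NZ d L => φ (rchart NeZero.one_le hR'L bj.1 bj.2.1) - V bj.1)) = φ := by
  classical
  have hL : 1 ≤ L := NeZero.one_le
  ext x'
  obtain ⟨j, hj⟩ := rchart_surj hL hR'L x'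
  rw [← hj, coordT_mulVec_rchart]
  by_cases hj0 : j = 0
  · subst hj0
    simp only [ne_eq, not_true_eq_false, dite_false, Sum.elim_inl, Sum.elim_inr]
    -- the block sum identity: `Σ_j φ(rchart b j) = L^{d+1} V_b`
    have hsum := hφ (rblk L R' x')
    rw [filter_rblk_eq_image hL hR'L, Finset.sum_image fun j _ j' _ h => rchart_injective hL hR'L _ h,
      sum_offsets_split] at hsum
    have hconst : ∑ _j : Fin (d + 1) → Fin L, V (rblk L R' x') = (L : ℝ) ^ (d + 1) * V (rblk L R' x') := by
      rw [Finset.sum_const, Finset.card_univ, Fintype.card_fun, Fintype.card_fin, Fintype.card_fin, nsmul_eq_mul]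
      push_cast
      ring
    rw [sum_offsets_split] at hconst
    rw [Finset.sum_sub_distrib]
    linarith
  · simp only [ne_eq, hj0, not_false_eq_true, dite_true, Sum.elim_inl, Sum.elim_inr]
    ring

/-- **THE SCHUR FORM IS BELOW THE RUN-B FORM OF EVERY FINE FUNCTION WITH THE RIGHT BLOCK SUMS**:
`⟨V,P_B^{Schur}V⟩ ≤ L^{−(d+1)}·⟨φ, fineOpR (nL) a 0 R′ φ⟩` whenever `Σ_{x′ ∈ block b} φ x′ = L^{d+1}V_b` for every block
(`a > 0`, `n ≥ 1`, `R′` a union of `nL`-blocks).  The constrained minimum behind the Schur complement, in the form consumed by trials.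
[folklore] -/
theorem schurB_form_le_of_blockSum (hn : 1 ≤ n) (hR' : IsBlockUnion (n * L) R') {a : ℝ} (ha : 0 < a)
    (V : ↥(R'.image (blk L)) → ℝ) (φ : ↥R' → ℝ)
    (hφ : ∀ b, ∑ x' ∈ Finset.univ.filter (fun x' => rblk L R' x' = b), φ x' = (L : ℝ) ^ (d + 1) * V b) :
    V ⬝ᵥ (twoCutoffLine (isBlockUnion_fine hR') n a 1).mulVec V ≤
      ((L : ℝ) ^ (d + 1))⁻¹ * (φ ⬝ᵥ (fineOpR (n * L) a 0 R').mulVec φ) := by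
  have hR'L : IsBlockUnion L R' := isBlockUnion_fine hR'
  have h := schurB_form_le_trial_fluct hn hR' ha V
    (fun bj : ↥(R'.image (blk L)) × NZ d L => φ (rchart NeZero.one_le hR'L bj.1 bj.2.1) - V bj.1)
  rwa [runB, dot_congr_mulVec, coordT_fluct hR'L V φ hφ] at h

/-- **REDUCTION OF THE UPPER TWO-RUN COMPARISON TO A DIRICHLET COMPARISON**: if a fine `φ` has block sums `L^{d+1}V` and its
nearest-neighbour energy satisfies `L²·Σ_{x′}Σ_{y′~x′}(φ x′ − φ y′)² ≤ C·L^{d+1}·Σ_xΣ_{y~x}(V_x − V_y)²` with `C ≥ 1`, then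
`⟨V,P_B^{Schur}V⟩ ≤ C·⟨V,P_A V⟩` (`a > 0`, `n ≥ 1`, `R′` a union of `nL`-blocks): the averaging parts are EQUAL (`avgPart_eq`),
the Dirichlet parts carry the normalisations `L^{−(d+1)}·(nL)²` vs `n²`. [folklore] -/
theorem schurB_form_le_of_dirichlet (hn : 1 ≤ n) (hR' : IsBlockUnion (n * L) R') {a : ℝ} (ha : 0 < a)
    (V : ↥(R'.image (blk L)) → ℝ) (φ : ↥R' → ℝ)
    (hφ : ∀ b, ∑ x' ∈ Finset.univ.filter (fun x' => rblk L R' x' = b), φ x' = (L : ℝ) ^ (d + 1) * V b)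
    {C : ℝ} (hC : 1 ≤ C)
    (hdir : (L : ℝ) ^ 2 * ∑ x' : ↥R', ∑ y' : ↥R', (if y'.1 ∈ nbrs x'.1 then (φ x' - φ y') ^ 2 else (0 : ℝ)) ≤
      C * (L : ℝ) ^ (d + 1) * ∑ x : ↥(R'.image (blk L)), ∑ y : ↥(R'.image (blk L)),
        (if y.1 ∈ nbrs x.1 then (V x - V y) ^ 2 else (0 : ℝ))) :
    V ⬝ᵥ (twoCutoffLine (isBlockUnion_fine hR') n a 1).mulVec V ≤ C * (V ⬝ᵥ (runA n L a R').mulVec V) := by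
  classical
  have hL : 1 ≤ L := NeZero.one_le
  have hR'L : IsBlockUnion L R' := isBlockUnion_fine hR'
  have hRc : IsBlockUnion n (R'.image (blk L)) := isBlockUnion_coarse hL hR'
  have hnL : 1 ≤ n * L := Nat.one_le_iff_ne_zero.2 (Nat.mul_ne_zero (Nat.one_le_iff_ne_zero.1 hn) (NeZero.ne L))
  have hLpos : (0 : ℝ) < L := by exact_mod_cast hL
  have hLpow : (0 : ℝ) < (L : ℝ) ^ (d + 1) := pow_pos hLpos _
  refine (schurB_form_le_of_blockSum hn hR' ha V φ hφ).trans ?_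
  rw [fineOpR_form hnL hR' a 0, runA, fineOpR_form hn hRc a 0, zero_mul, add_zero, zero_mul, add_zero, mul_add, mul_add]
  have havg := avgPart_eq hn a φ V hφ
  rw [havg]
  have hcoarse_nn : 0 ≤ ∑ x : ↥(R'.image (blk L)), ∑ y : ↥(R'.image (blk L)),
      (if y.1 ∈ nbrs x.1 then (V x - V y) ^ 2 else (0 : ℝ)) :=
    Finset.sum_nonneg fun _ _ => Finset.sum_nonneg fun _ _ => by split_ifs <;> positivity
  have havg_nn : 0 ≤ a * ((n : ℝ) ^ (d + 1))⁻¹ * ∑ B₀ : ↥((R'.image (blk L)).image (blk n)),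
      (∑ b ∈ Finset.univ.filter (fun b => rblk n (R'.image (blk L)) b = B₀), V b) ^ 2 := by
    have : 0 ≤ ∑ B₀ : ↥((R'.image (blk L)).image (blk n)),
        (∑ b ∈ Finset.univ.filter (fun b => rblk n (R'.image (blk L)) b = B₀), V b) ^ 2 :=
      Finset.sum_nonneg fun _ _ => sq_nonneg _
    positivity
  have hdir' : ((L : ℝ) ^ (d + 1))⁻¹ * (((n * L : ℕ) : ℝ) ^ 2 / 2 *
      ∑ x' : ↥R', ∑ y' : ↥R', (if y'.1 ∈ nbrs x'.1 then (φ x' - φ y') ^ 2 else 0)) ≤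
      C * ((n : ℝ) ^ 2 / 2 * ∑ x : ↥(R'.image (blk L)), ∑ y : ↥(R'.image (blk L)),
        (if y.1 ∈ nbrs x.1 then (V x - V y) ^ 2 else 0)) := by
    have h1 := mul_le_mul_of_nonneg_left hdir (show (0 : ℝ) ≤ ((L : ℝ) ^ (d + 1))⁻¹ * ((n : ℝ) ^ 2 / 2) by positivity)
    have e1 : ((L : ℝ) ^ (d + 1))⁻¹ * ((n : ℝ) ^ 2 / 2) * ((L : ℝ) ^ 2 *
        ∑ x' : ↥R', ∑ y' : ↥R', (if y'.1 ∈ nbrs x'.1 then (φ x' - φ y') ^ 2 else 0)) =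
        ((L : ℝ) ^ (d + 1))⁻¹ * (((n * L : ℕ) : ℝ) ^ 2 / 2 *
          ∑ x' : ↥R', ∑ y' : ↥R', (if y'.1 ∈ nbrs x'.1 then (φ x' - φ y') ^ 2 else 0)) := by
      push_cast; ring
    have e2 : ((L : ℝ) ^ (d + 1))⁻¹ * ((n : ℝ) ^ 2 / 2) * (C * (L : ℝ) ^ (d + 1) *
        ∑ x : ↥(R'.image (blk L)), ∑ y : ↥(R'.image (blk L)), (if y.1 ∈ nbrs x.1 then (V x - V y) ^ 2 else 0)) =
        C * ((n : ℝ) ^ 2 / 2 * ∑ x : ↥(R'.image (blk L)), ∑ y : ↥(R'.image (blk L)),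
          (if y.1 ∈ nbrs x.1 then (V x - V y) ^ 2 else 0)) := by
      field_simp
    rw [e1, e2] at h1
    exact h1
  have hA := le_mul_of_one_le_left havg_nn hC
  linarith [hdir', hA]

end Trial

end Summit.QuantumFields.BalabanUV.T4Continuum.NE7K1LinHomTrial
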